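import Summits.Ventures.LatticeQCDFlow.Scaling.ReplicaExchangeModeTorpid
import Literature.Probability.MarkovChains.DistinguishingStatistic
import Literature.Probability.MarkovChains.StateDecomposition

/-!
HONEST FRAMING: exact (Metropolis-corrected) sampling algorithms for lattice gauge theory; figures
of merit are autocorrelation/cost numbers at stated couplings and volumes; no continuum-physics
claim.

# SectorCountMixingFloor — THE LINEAR LAW WITHOUT REVERSIBILITY: IF ONE STEP RAISES THE EXPECTED NUMBER OF REPLICAS
# IN A SECTOR `A` BY AT MOST `p`, THEN EVERY `t` WITH `d(t) ≤ 1/4` HAS `Σ_k μ_k(A) < 8tp` — FOR EVERY TRANSITION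
# MATRIX WHATSOEVER (non-reversible / deterministic-scan exchange schedules included); COUNT-PRESERVING EXCHANGE
# MOVES CONTRIBUTE `0` TO `p`, COLD-SECTOR-PRESERVING UPDATES `≤ 1` PER APPLICATION, `prodKernel w M` ONLY `w_0`
# (lean-2 GEN-20, ours)

Venture-side (OURS).  Cell `lqcd-flow` (pub-lqcd), unit `pub-lqcd-lean-2-g20`, 2026-08-25.  Chapter H.  The
spectral ceilings of `ExchangeSchemeSectorCeiling` / `ExchangeSchemeHandoverCeiling` / `SweepSchemeSectorCeiling` need
a REVERSIBLE sampler (Rayleigh quotients); production replica-exchange codes compose a sweep of all replicas with a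
deterministic pass over the swap pairs, and lifted non-reversible schedules are used precisely because they move
labels ballistically.  This file drops reversibility by the distinguishing-statistic method (Levin–Peres–Wilmer
§7.3) with the statistic `N_A(x) = #{k : x_k ∈ A}` on `Fin (K+1) → S`, comparing the chain started with every replica
outside `A` to the product target `π̃ = ⊗_k μ_k` (`tensorFun μ`); `m̄ := Σ_k μ_k(A) = E_π̃ N_A`.

## What is proved

* §1 (generic: finite `X`, row-stochastic `P`, `f ≥ 0`) DRIFT `Σ_y P(x,y)f(y) ≤ f(x) + p` ⇒ `lawMean_stepLaw_le`,
  `lawMean_lawAt_le` (`E f(X_t) ≤ E f(X_0) + tp`); Markov `mass_ge_le_lawMean_div`; `drift_of_preserving` (`0`),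
  `drift_mixture`, `drift_comp` (matrix product: drifts add); **`tvDist_ge_of_drift`**
  (`‖Pᵗ(x₀,·) − π‖ ≥ π{f ≥ n} − (f(x₀) + tp)/n`); **`lt_of_worstTvDist_le`** (`π{f ≥ n} ≥ 3/4`, `d(t) ≤ 1/4` ⇒
  `n < 4(f(x₀) + tp)`).
* §2 `tensorFun_lawMean_sectorCount` (`m̄`), `tensorFun_lawVariance_sectorCount` (`Σ_k μ_k(A)μ_k(Aᶜ) ≤ m̄`),
  **`tensorFun_mass_sectorCount_ge`** (Chebyshev: `π̃{N_A ≥ m̄/2} ≥ 1 − 4/m̄`).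
* §3 `drift_exchange_sectorCount` (count-preserving `Q`: `0`), `drift_prodKernel_sectorCount` (cold replicas frozen,
  `M_k(u,v) ≠ 0 ⇒ (u ∈ A ↔ v ∈ A)` for `k ≠ 0`: `≤ w_0`), `drift_coldPreserving_sectorCount` (ANY kernel keeping the
  cold replicas' sector labels: `≤ 1`).
* §4 (`m̄ ≥ 16`, a point `u₀ ∉ A`, `d(t) ≤ 1/4`) **`sectorCount_mixing_floor`**: any `P` with drift `≤ p` ⇒
  `m̄ < 8tp`; **`weightedScheme_mixing_floor`**: `P = sQ + (1−s)·prodKernel w M` ⇒ `m̄ < 8t(1−s)w_0`;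
  **`coldPreservingScheme_mixing_floor`**: the COMPOSITION `U * Q`, `U` any cold-label-preserving update (e.g. a
  parallel sweep with frozen cold replicas) ⇒ `m̄ < 8t`.  With
  `μ_k(A) ≥ a` (`m̄ ≥ (K+1)a`): order `K²` steps for uniform single-replica updates, order `K` sweeps.

Reading (no numerics implied): from the all-wrong-sector start the sampler must raise the sector count to about `m̄`;
exchanges never raise it, frozen cold updates never raise it, the tunnelling replica raises it by at most one per
update it receives — so ANY exact replica-exchange scheme, reversible or not, with any swap schedule, needs order
`m̄/p` steps.  NOT CLAIMED: relaxation-time (spectral) statements for non-reversible schemes; anything measured.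
Literature grade (cell rule): KNOWN METHOD (Levin–Peres–Wilmer Prop. 7.9, the tree's `DistinguishingStatistic`), NEW
TYPING (drift calculus for exchange schemes); nothing cited as a fact; no new bib keys.
-/

noncomputable section

open Finset Function Matrix
open Literature.Probability.MarkovChains

namespace Summit.Ventures.LatticeQCDFlow.Scaling

/-! ## §1 Drift, Markov, and the distinguishing-statistic floor (generic) -/

section Generic

variable {X : Type*} [Fintype X]

/-- **One step raises the mean by at most the drift:** `Σ_y P(x,y)f(y) ≤ f(x) + p` for all `x` and `μ ≥ 0` give
`E_{μP} f ≤ E_μ f + p·Σμ`. [ours] -/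
theorem lawMean_stepLaw_le {P : X → X → ℝ} {f : X → ℝ} {p : ℝ} (hdrift : ∀ x, ∑ y, P x y * f y ≤ f x + p)
    {μ : X → ℝ} (hμ : ∀ x, 0 ≤ μ x) : lawMean (stepLaw P μ) f ≤ lawMean μ f + p * ∑ x, μ x := by
  unfold lawMean stepLaw
  calc ∑ y, (∑ x, μ x * P x y) * f y = ∑ y, ∑ x, μ x * P x y * f y := by simp_rw [Finset.sum_mul]
    _ = ∑ x, ∑ y, μ x * P x y * f y := Finset.sum_comm
    _ = ∑ x, μ x * ∑ y, P x y * f y := by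
        refine sum_congr rfl fun x _ => ?_
        rw [Finset.mul_sum]
        exact sum_congr rfl fun y _ => by ring
    _ ≤ ∑ x, μ x * (f x + p) := sum_le_sum fun x _ => mul_le_mul_of_nonneg_left (hdrift x) (hμ x)
    _ = ∑ x, μ x * f x + p * ∑ x, μ x := by rw [Finset.mul_sum, ← Finset.sum_add_distrib]; exact sum_congr rfl fun x _ => by ring

/-- **`t` steps raise the mean by at most `t·p`** (`P` row-stochastic, `μ` a probability vector). [ours] -/
theorem lawMean_lawAt_le {P : X → X → ℝ} (hP : IsRowStochastic P) {f : X → ℝ} {p : ℝ}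
    (hdrift : ∀ x, ∑ y, P x y * f y ≤ f x + p) {μ : X → ℝ} (hμ : ∀ x, 0 ≤ μ x) (hμ1 : ∑ x, μ x = 1)
    (t : ℕ) : lawMean (lawAt P μ t) f ≤ lawMean μ f + t * p := by
  induction t with
  | zero => simp [lawAt_zero]
  | succ t ih =>
    rw [lawAt_succ]
    have h := lawMean_stepLaw_le hdrift (lawAt_nonneg hP hμ t)
    rw [sum_lawAt hP, hμ1, mul_one] at h
    push_cast
    linarith

/-- **Markov's inequality:** `ν{f ≥ n} ≤ E_ν f/n` for `ν ≥ 0`, `f ≥ 0`, `n > 0`. [folklore] -/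
theorem mass_ge_le_lawMean_div {ν : X → ℝ} (hν : ∀ x, 0 ≤ ν x) {f : X → ℝ} (hf : ∀ x, 0 ≤ f x) {n : ℝ}
    (hn : 0 < n) : ∑ x ∈ univ.filter (fun x => n ≤ f x), ν x ≤ lawMean ν f / n := by
  rw [le_div_iff₀ hn, Finset.sum_mul]
  unfold lawMean
  calc ∑ x ∈ univ.filter (fun x => n ≤ f x), ν x * n ≤ ∑ x ∈ univ.filter (fun x => n ≤ f x), ν x * f x :=
        sum_le_sum fun x hx => mul_le_mul_of_nonneg_left (mem_filter.mp hx).2 (hν x)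
    _ ≤ ∑ x, ν x * f x :=
        sum_le_sum_of_subset_of_nonneg (filter_subset _ _) fun x _ _ => mul_nonneg (hν x) (hf x)

/-- Zero drift for a kernel that never changes `f`. [ours] -/
theorem drift_of_preserving {Q : X → X → ℝ} (hQ : IsRowStochastic Q) {f : X → ℝ}
    (hQf : ∀ x y, Q x y ≠ 0 → f y = f x) (x : X) : ∑ y, Q x y * f y ≤ f x + 0 := by
  rw [add_zero]
  have h : ∑ y, Q x y * f y = ∑ y, Q x y * f x := sum_congr rfl fun y _ => by
    by_cases hq : Q x y = 0
    · rw [hq, zero_mul, zero_mul]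
    · rw [hQf x y hq]
  rw [h, ← Finset.sum_mul, hQ.2 x, one_mul]

/-- Drift of a mixture: `s·p_Q + (1−s)·p_U` (`0 ≤ s ≤ 1`). [ours] -/
theorem drift_mixture {Q U : X → X → ℝ} {f : X → ℝ} {pQ pU s : ℝ} (hs0 : 0 ≤ s) (hs1 : s ≤ 1)
    (hQ : ∀ x, ∑ y, Q x y * f y ≤ f x + pQ) (hU : ∀ x, ∑ y, U x y * f y ≤ f x + pU) (x : X) :
    ∑ y, (s * Q x y + (1 - s) * U x y) * f y ≤ f x + (s * pQ + (1 - s) * pU) := by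
  have e : ∑ y, (s * Q x y + (1 - s) * U x y) * f y = s * ∑ y, Q x y * f y + (1 - s) * ∑ y, U x y * f y := by
    rw [Finset.mul_sum, Finset.mul_sum, ← Finset.sum_add_distrib]
    exact sum_congr rfl fun y _ => by ring
  rw [e]
  nlinarith [hQ x, hU x]

/-- Drift of a COMPOSITION (the matrix product `Q * U`: first `Q`, then `U`): `p_Q + p_U` (`Q` row-stochastic).
[ours] -/
theorem drift_comp {Q U : Matrix X X ℝ} (hQ : IsRowStochastic Q) {f : X → ℝ} {pQ pU : ℝ}
    (hQf : ∀ x, ∑ y, Q x y * f y ≤ f x + pQ) (hUf : ∀ x, ∑ y, U x y * f y ≤ f x + pU) (x : X) :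
    ∑ y, (Q * U) x y * f y ≤ f x + (pQ + pU) := by
  simp_rw [Matrix.mul_apply]
  calc ∑ y, (∑ z, Q x z * U z y) * f y = ∑ y, ∑ z, Q x z * U z y * f y := by simp_rw [Finset.sum_mul]
    _ = ∑ z, ∑ y, Q x z * U z y * f y := Finset.sum_comm
    _ = ∑ z, Q x z * ∑ y, U z y * f y := by
        refine sum_congr rfl fun z _ => ?_
        rw [Finset.mul_sum]
        exact sum_congr rfl fun y _ => by ring
    _ ≤ ∑ z, Q x z * (f z + pU) := sum_le_sum fun z _ => mul_le_mul_of_nonneg_left (hUf z) (hQ.1 x z)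
    _ = ∑ z, Q x z * f z + pU := by
        simp_rw [mul_add]
        rw [Finset.sum_add_distrib, ← Finset.sum_mul, hQ.2 x, one_mul]
    _ ≤ f x + (pQ + pU) := by linarith [hQf x]

variable [DecidableEq X]

/-- **THE DISTINGUISHING-STATISTIC FLOOR:** `‖Pᵗ(x₀,·) − π‖_TV ≥ π{f ≥ n} − (f(x₀) + t·p)/n` for a row-stochastic
`P`, a probability vector `π`, `f ≥ 0` with drift `≤ p`, `n > 0`. [ours; the method of Levin–Peres–Wilmer §7.3] -/
theorem tvDist_ge_of_drift {P : X → X → ℝ} (hP : IsRowStochastic P) {π : X → ℝ} (hπ1 : ∑ x, π x = 1)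
    {f : X → ℝ} (hf : ∀ x, 0 ≤ f x) {p : ℝ} (hdrift : ∀ x, ∑ y, P x y * f y ≤ f x + p) {n : ℝ}
    (hn : 0 < n) (x₀ : X) (t : ℕ) :
    ∑ x ∈ univ.filter (fun x => n ≤ f x), π x - (f x₀ + t * p) / n
      ≤ tvDist (lawAt P (Pi.single x₀ 1) t) π := by
  have h0 : ∀ z, 0 ≤ (Pi.single x₀ (1 : ℝ) : X → ℝ) z := fun z => by
    rw [Pi.single_apply]; split_ifs <;> norm_num
  have h1 : ∑ z, (Pi.single x₀ (1 : ℝ) : X → ℝ) z = 1 := by rw [Finset.sum_pi_single']; simp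
  have hmass : ∑ z, lawAt P (Pi.single x₀ 1) t z = ∑ z, π z := by rw [sum_lawAt hP, h1, hπ1]
  have hev := sub_sum_le_tvDist hmass.symm (univ.filter (fun x => n ≤ f x))
  rw [tvDist_comm] at hev
  have hmk := mass_ge_le_lawMean_div (lawAt_nonneg hP h0 t) hf hn (ν := lawAt P (Pi.single x₀ 1) t)
  have hmean := lawMean_lawAt_le hP hdrift h0 h1 t
  have hstart : lawMean (Pi.single x₀ (1 : ℝ)) f = f x₀ := by
    unfold lawMean
    rw [Finset.sum_eq_single x₀ (fun z _ hz => by rw [Pi.single_eq_of_ne hz, zero_mul])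
      (fun h => absurd (mem_univ _) h), Pi.single_eq_same, one_mul]
  rw [hstart] at hmean
  have : ∑ x ∈ univ.filter (fun x => n ≤ f x), lawAt P (Pi.single x₀ 1) t x ≤ (f x₀ + t * p) / n :=
    hmk.trans (div_le_div_of_nonneg_right hmean hn.le)
  linarith

/-- **Every `t` with `d(t) ≤ 1/4` satisfies `n < 4·(f(x₀) + t·p)`** when `π{f ≥ n} ≥ 3/4` — the mixing time from
the worst start is at least the time needed to push the statistic up to `n/4` in expectation. [ours] -/
theorem lt_of_worstTvDist_le {P : X → X → ℝ} (hP : IsRowStochastic P) {π : X → ℝ} (hπ1 : ∑ x, π x = 1)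
    {f : X → ℝ} (hf : ∀ x, 0 ≤ f x) {p : ℝ} (hdrift : ∀ x, ∑ y, P x y * f y ≤ f x + p) {n : ℝ}
    (hn : 0 < n) (hπn : 3 / 4 ≤ ∑ x ∈ univ.filter (fun x => n ≤ f x), π x) (x₀ : X) {t : ℕ}
    (ht : worstTvDist P π t ≤ 1 / 4) : n < 4 * (f x₀ + t * p) := by
  have h := (tvDist_ge_of_drift hP hπ1 hf hdrift hn x₀ t).trans
    ((tvDist_single_le_worstTvDist P π t x₀).trans ht)
  -- `3/4 − (f x₀ + tp)/n ≤ 1/4` ⇒ `n/2 ≤ f x₀ + tp`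
  have h2 : (1 : ℝ) / 2 ≤ (f x₀ + t * p) / n := by linarith
  rw [le_div_iff₀ hn] at h2
  linarith

end Generic

/-! ## §2 The sector count under the product law -/

variable {S : Type*} [Fintype S] [DecidableEq S] {K : ℕ} {μ : Fin (K + 1) → S → ℝ}
  {M : Fin (K + 1) → S → S → ℝ} {w : Fin (K + 1) → ℝ}

/-- **`E_π̃ N_A = Σ_k μ_k(A)`.** [ours] -/
theorem tensorFun_lawMean_sectorCount (hμ1 : ∀ k, ∑ u, μ k u = 1) (A : Finset S) :
    lawMean (tensorFun μ) (fun x : Fin (K + 1) → S => ∑ k, (if x k ∈ A then (1 : ℝ) else 0))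
      = ∑ k, ∑ u ∈ A, μ k u := by
  unfold lawMean
  rw [sum_tensorFun_mul_additive μ hμ1 (fun k u => if u ∈ A then (1 : ℝ) else 0)]
  refine sum_congr rfl fun k _ => ?_
  simp_rw [mul_ite, mul_one, mul_zero]
  rw [← Finset.sum_filter, Finset.filter_mem_eq_inter, Finset.univ_inter]

/-- **`Var_π̃ N_A = Σ_k μ_k(A)μ_k(Aᶜ)`** (independent coordinates; the centred count is `−Σ_k f_A^{(μ_k)}(x_k)`).
[ours] -/
theorem tensorFun_lawVariance_sectorCount (hμ1 : ∀ k, ∑ u, μ k u = 1) (A : Finset S) :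
    lawVariance (tensorFun μ) (fun x : Fin (K + 1) → S => ∑ k, (if x k ∈ A then (1 : ℝ) else 0))
      = ∑ k, (∑ u ∈ A, μ k u) * ∑ u ∈ Aᶜ, μ k u := by
  have hc : ∀ x : Fin (K + 1) → S, (∑ k, (if x k ∈ A then (1 : ℝ) else 0)) - ∑ k, ∑ u ∈ A, μ k u
      = -∑ k, bottleneckTestFun (μ k) A (x k) := by
    intro x
    rw [← Finset.sum_sub_distrib, ← Finset.sum_neg_distrib]
    refine sum_congr rfl fun k _ => ?_
    rw [bottleneckTestFun_eq (hμ1 k)]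
    have : ∑ u ∈ A, μ k u + ∑ u ∈ Aᶜ, μ k u = 1 := by rw [Finset.sum_add_sum_compl, hμ1 k]
    split_ifs <;> linarith
  unfold lawVariance
  rw [tensorFun_lawMean_sectorCount hμ1 A]
  simp_rw [hc, neg_sq]
  have h := piInner_tensorFun_additive μ hμ1 (fun k => bottleneckTestFun (μ k) A)
    (fun k => sum_mul_bottleneckTestFun (μ k) A)
  unfold piInner at h
  simp_rw [← sq] at h
  rw [h]
  exact sum_congr rfl fun k _ => by
    rw [← piInner_bottleneckTestFun (hμ1 k) A]; unfold piInner; exact sum_congr rfl fun u _ => by ring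

/-- **CHEBYSHEV FOR THE COUNT: `π̃{N_A ≥ m̄/2} ≥ 1 − 4/m̄`** with `m̄ = Σ_k μ_k(A) > 0` (`Var ≤ m̄`). [ours] -/
theorem tensorFun_mass_sectorCount_ge (hμ : ∀ k x, 0 < μ k x) (hμ1 : ∀ k, ∑ u, μ k u = 1) (A : Finset S)
    (hm : 0 < ∑ k : Fin (K + 1), ∑ u ∈ A, μ k u) :
    1 - 4 / (∑ k : Fin (K + 1), ∑ u ∈ A, μ k u)
      ≤ ∑ x ∈ univ.filter (fun x : Fin (K + 1) → S => (∑ k : Fin (K + 1), ∑ u ∈ A, μ k u) / 2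
            ≤ ∑ k, (if x k ∈ A then (1 : ℝ) else 0)), tensorFun μ x := by
  set m := ∑ k : Fin (K + 1), ∑ u ∈ A, μ k u with hm_def
  set f : (Fin (K + 1) → S) → ℝ := fun x => ∑ k, (if x k ∈ A then (1 : ℝ) else 0) with hf
  have hπ0 : ∀ x, 0 ≤ tensorFun μ x := fun x => (tensorFun_pos hμ x).le
  have hmean : lawMean (tensorFun μ) f = m := tensorFun_lawMean_sectorCount hμ1 A
  have hdev := sum_filter_le_lawVariance_div_sq hπ0 f (a := m / 2) (by positivity)
  rw [hmean, tensorFun_lawVariance_sectorCount hμ1 A] at hdev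
  have hVar : ∑ k : Fin (K + 1), (∑ u ∈ A, μ k u) * ∑ u ∈ Aᶜ, μ k u ≤ m := by
    refine sum_le_sum fun k _ => mul_le_of_le_one_right (sum_nonneg fun u _ => (hμ k u).le) ?_
    rw [← hμ1 k]; exact sum_le_sum_of_subset_of_nonneg (subset_univ _) fun u _ _ => (hμ k u).le
  have hdev' : ∑ x ∈ univ.filter (fun x => m / 2 ≤ |f x - m|), tensorFun μ x ≤ 4 / m := by
    refine hdev.trans ?_
    rw [div_le_div_iff₀ (by positivity) hm]
    nlinarith
  have hsub : (univ.filter (fun x => m / 2 ≤ |f x - m|))ᶜ ⊆ univ.filter (fun x => m / 2 ≤ f x) := by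
    intro x hx
    rw [Finset.mem_compl, Finset.mem_filter, not_and] at hx
    have h := hx (mem_univ x); rw [not_le, abs_lt] at h
    exact mem_filter.mpr ⟨mem_univ _, by linarith [h.1]⟩
  have htot : ∑ x ∈ univ.filter (fun x => m / 2 ≤ |f x - m|), tensorFun μ x
      + ∑ x ∈ (univ.filter (fun x => m / 2 ≤ |f x - m|))ᶜ, tensorFun μ x = 1 := by
    rw [Finset.sum_add_sum_compl, sum_tensorFun_eq_one μ hμ1]
  calc 1 - 4 / m ≤ ∑ x ∈ (univ.filter (fun x => m / 2 ≤ |f x - m|))ᶜ, tensorFun μ x := by linarith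
    _ ≤ _ := sum_le_sum_of_subset_of_nonneg hsub fun x _ _ => hπ0 x

/-! ## §3 Drift of the building blocks -/

/-- **A count-preserving exchange move has drift `0`.** [ours] -/
theorem drift_exchange_sectorCount {Q : Matrix (Fin (K + 1) → S) (Fin (K + 1) → S) ℝ} (hQ : IsRowStochastic Q)
    {A : Finset S}
    (hQA : ∀ x y, Q x y ≠ 0 → ∑ k, (if y k ∈ A then (1 : ℝ) else 0) = ∑ k, (if x k ∈ A then (1 : ℝ) else 0))
    (x : Fin (K + 1) → S) :
    ∑ y, Q x y * (∑ k, (if y k ∈ A then (1 : ℝ) else 0)) ≤ (∑ k, (if x k ∈ A then (1 : ℝ) else 0)) + 0 :=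
  drift_of_preserving hQ hQA x

omit [Fintype S] in
/-- One coordinate update changes the count by the change of that coordinate's indicator. [ours] -/
theorem sectorCount_update [Fintype S] (A : Finset S) (x : Fin (K + 1) → S) (k : Fin (K + 1)) (v : S) :
    (∑ i, (if update x k v i ∈ A then (1 : ℝ) else 0))
      = (∑ i, (if x i ∈ A then (1 : ℝ) else 0)) - (if x k ∈ A then (1 : ℝ) else 0) + (if v ∈ A then (1 : ℝ) else 0) := by
  rw [← Finset.add_sum_erase univ _ (mem_univ k), ← Finset.add_sum_erase univ (fun i => if x i ∈ A then (1:ℝ) else 0)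
    (mem_univ k), update_self]
  have : ∑ i ∈ univ.erase k, (if update x k v i ∈ A then (1 : ℝ) else 0) = ∑ i ∈ univ.erase k, (if x i ∈ A then (1:ℝ) else 0) :=
    sum_congr rfl fun i hi => by rw [update_of_ne (Finset.ne_of_mem_erase hi)]
  rw [this]
  ring

/-- **`prodKernel w M` with sector-frozen cold replicas has drift `≤ w_0`:** only the hot replica's update can raise
the count, by at most one, and it is chosen with probability `w_0` (`w ≥ 0`, `M_k` row-stochastic,
`M_k(u,v) ≠ 0 ⇒ (u ∈ A ↔ v ∈ A)` for `k ≠ 0`). [ours] -/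
theorem drift_prodKernel_sectorCount (hM : ∀ k, IsRowStochastic (M k)) (hw0 : ∀ k, 0 ≤ w k) (hw1 : ∑ k, w k = 1)
    {A : Finset S} (hfrozen : ∀ k : Fin (K + 1), k ≠ 0 → ∀ u v, M k u v ≠ 0 → (u ∈ A ↔ v ∈ A)) (x : Fin (K + 1) → S) :
    ∑ y, prodKernel w M x y * (∑ i, (if y i ∈ A then (1 : ℝ) else 0))
      ≤ (∑ i, (if x i ∈ A then (1 : ℝ) else 0)) + w 0 := by
  rw [sum_prodKernel_mul M w x]
  simp_rw [sectorCount_update]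
  have hk : ∀ k : Fin (K + 1), w k * ∑ v, M k (x k) v * ((∑ i, (if x i ∈ A then (1 : ℝ) else 0))
      - (if x k ∈ A then (1 : ℝ) else 0) + (if v ∈ A then (1 : ℝ) else 0))
      ≤ w k * (∑ i, (if x i ∈ A then (1 : ℝ) else 0)) + (if k = 0 then w 0 else 0) := by
    intro k
    have hrow := (hM k).2 (x k)
    have hsplit : ∑ v, M k (x k) v * ((∑ i, (if x i ∈ A then (1 : ℝ) else 0))
        - (if x k ∈ A then (1 : ℝ) else 0) + (if v ∈ A then (1 : ℝ) else 0))
        = (∑ i, (if x i ∈ A then (1 : ℝ) else 0)) - (if x k ∈ A then (1 : ℝ) else 0)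
          + ∑ v, M k (x k) v * (if v ∈ A then (1 : ℝ) else 0) := by
      simp_rw [mul_add, mul_sub]
      rw [Finset.sum_add_distrib, Finset.sum_sub_distrib, ← Finset.sum_mul, hrow, one_mul, ← Finset.sum_mul, hrow, one_mul]
    rw [hsplit]
    by_cases hk0 : k = 0
    · subst hk0
      rw [if_pos rfl]
      have h1 : ∑ v, M 0 (x 0) v * (if v ∈ A then (1 : ℝ) else 0) ≤ 1 := by
        calc ∑ v, M 0 (x 0) v * (if v ∈ A then (1 : ℝ) else 0) ≤ ∑ v, M 0 (x 0) v :=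
              sum_le_sum fun v _ => by
                split_ifs
                · rw [mul_one]
                · rw [mul_zero]; exact (hM 0).1 _ _
          _ = 1 := hrow
      have h2 : 0 ≤ (if x 0 ∈ A then (1 : ℝ) else 0) := by split_ifs <;> norm_num
      nlinarith [hw0 0]
    · rw [if_neg hk0, add_zero]
      have hfz : ∑ v, M k (x k) v * (if v ∈ A then (1 : ℝ) else 0) = (if x k ∈ A then (1 : ℝ) else 0) := by
        have : ∀ v, M k (x k) v * (if v ∈ A then (1 : ℝ) else 0) = M k (x k) v * (if x k ∈ A then (1 : ℝ) else 0) := by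
          intro v; by_cases hz : M k (x k) v = 0
          · rw [hz, zero_mul, zero_mul]
          · rw [if_congr (hfrozen k hk0 (x k) v hz).symm rfl rfl]
        rw [Finset.sum_congr rfl fun v _ => this v, ← Finset.sum_mul, hrow, one_mul]
      rw [hfz]
      linarith
  refine (sum_le_sum fun k _ => hk k).trans ?_
  rw [Finset.sum_add_distrib, ← Finset.sum_mul, Finset.sum_ite_eq' univ (0 : Fin (K + 1)), if_pos (mem_univ _), hw1,
    one_mul]

/-- **Any update that never changes a COLD replica's sector label has drift `≤ 1`** — whatever it does to the hot
replica and however the replicas are coupled (e.g. a full parallel sweep with sector-frozen cold updates). [ours] -/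
theorem drift_coldPreserving_sectorCount {U : Matrix (Fin (K + 1) → S) (Fin (K + 1) → S) ℝ} (hU : IsRowStochastic U)
    {A : Finset S} (hcold : ∀ x y, U x y ≠ 0 → ∀ k : Fin (K + 1), k ≠ 0 → (y k ∈ A ↔ x k ∈ A))
    (x : Fin (K + 1) → S) :
    ∑ y, U x y * (∑ k, (if y k ∈ A then (1 : ℝ) else 0)) ≤ (∑ k, (if x k ∈ A then (1 : ℝ) else 0)) + 1 := by
  have hle : ∀ y, U x y * (∑ k, (if y k ∈ A then (1 : ℝ) else 0))
      ≤ U x y * ((∑ k, (if x k ∈ A then (1 : ℝ) else 0)) + 1) := by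
    intro y
    by_cases hy : U x y = 0
    · rw [hy, zero_mul, zero_mul]
    · refine mul_le_mul_of_nonneg_left ?_ (hU.1 x y)
      rw [Fin.sum_univ_succ, Fin.sum_univ_succ]
      have hc : ∑ j : Fin K, (if y j.succ ∈ A then (1 : ℝ) else 0) = ∑ j : Fin K, (if x j.succ ∈ A then (1 : ℝ) else 0) :=
        sum_congr rfl fun j _ => if_congr (hcold x y hy j.succ (Fin.succ_ne_zero j)) rfl rfl
      rw [hc]
      have h0 : (if y 0 ∈ A then (1 : ℝ) else 0) ≤ 1 := by split_ifs <;> norm_num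
      have h0' : 0 ≤ (if x 0 ∈ A then (1 : ℝ) else 0) := by split_ifs <;> norm_num
      linarith
  refine (sum_le_sum fun y _ => hle y).trans ?_
  rw [← Finset.sum_mul, hU.2 x, one_mul]

/-! ## §4 The floors -/

section Floors

variable (hμ : ∀ k x, 0 < μ k x) (hμ1 : ∀ k, ∑ u, μ k u = 1) {A : Finset S} {u₀ : S} (hu₀ : u₀ ∉ A)
  (hm : 16 ≤ ∑ k : Fin (K + 1), ∑ u ∈ A, μ k u)
include hμ hμ1 hu₀ hm

/-- **THE LINEAR LAW WITHOUT REVERSIBILITY:** for ANY transition matrix `P` on `Fin (K+1) → S` whose one-step expected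
increase of the sector count is at most `p`, a sector with `m̄ = Σ_k μ_k(A) ≥ 16` missing a point `u₀`, and every
`t` with `d(t) ≤ 1/4` (distance to `π̃ = ⊗μ_k` from the worst start): `m̄ < 8·t·p`. [ours] -/
theorem sectorCount_mixing_floor {P : Matrix (Fin (K + 1) → S) (Fin (K + 1) → S) ℝ} (hP : IsRowStochastic P)
    {p : ℝ} (hdrift : ∀ x : Fin (K + 1) → S, ∑ y, P x y * (∑ k, (if y k ∈ A then (1 : ℝ) else 0))
      ≤ (∑ k, (if x k ∈ A then (1 : ℝ) else 0)) + p)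
    {t : ℕ} (ht : worstTvDist P (tensorFun μ) t ≤ 1 / 4) : ∑ k : Fin (K + 1), ∑ u ∈ A, μ k u < 8 * t * p := by
  set m := ∑ k : Fin (K + 1), ∑ u ∈ A, μ k u with hm_def
  have hmpos : 0 < m := by linarith
  have hf0 : ∀ x : Fin (K + 1) → S, 0 ≤ ∑ k, (if x k ∈ A then (1 : ℝ) else 0) :=
    fun x => sum_nonneg fun k _ => by split_ifs <;> norm_num
  have hmass := tensorFun_mass_sectorCount_ge hμ hμ1 A hmpos
  have h34 : (3 : ℝ) / 4 ≤ 1 - 4 / m := by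
    have : 4 / m ≤ 1 / 4 := by rw [div_le_iff₀ hmpos]; linarith
    linarith
  have h := lt_of_worstTvDist_le hP (sum_tensorFun_eq_one μ hμ1) hf0 hdrift (half_pos hmpos) (h34.trans hmass)
    (fun _ : Fin (K + 1) => u₀) ht
  simp only [hu₀, if_false, Finset.sum_const_zero, zero_add] at h
  linarith

/-- **THE WEIGHTED EXCHANGE SCHEME, REVERSIBLE OR NOT: `d(t) ≤ 1/4 ⇒ m̄ < 8·t·(1−s)·w_0`** — for any transition
matrix of the form `P = s·Q + (1−s)·prodKernel w M` with `Q` count-preserving (no reversibility asked), cold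
replicas frozen pointwise, `w` a probability vector, `0 ≤ s ≤ 1`.  With `μ_k(A) ≥ a` this reads
`t > (K+1)a/(8(1−s)w_0)`: order `K²` steps for uniform weights, order `K` for `w_0 = O(1)`. [ours] -/
theorem weightedScheme_mixing_floor {P Q : Matrix (Fin (K + 1) → S) (Fin (K + 1) → S) ℝ} (hP : IsRowStochastic P)
    (hQ : IsRowStochastic Q) {s : ℝ} (hs0 : 0 ≤ s) (hs1 : s ≤ 1)
    (hPdef : ∀ x y, P x y = s * Q x y + (1 - s) * prodKernel w M x y)
    (hQA : ∀ x y, Q x y ≠ 0 → ∑ k, (if y k ∈ A then (1 : ℝ) else 0) = ∑ k, (if x k ∈ A then (1 : ℝ) else 0))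
    (hM : ∀ k, IsRowStochastic (M k)) (hw0 : ∀ k, 0 ≤ w k) (hw1 : ∑ k, w k = 1)
    (hfrozen : ∀ k : Fin (K + 1), k ≠ 0 → ∀ u v, M k u v ≠ 0 → (u ∈ A ↔ v ∈ A))
    {t : ℕ} (ht : worstTvDist P (tensorFun μ) t ≤ 1 / 4) :
    ∑ k : Fin (K + 1), ∑ u ∈ A, μ k u < 8 * t * ((1 - s) * w 0) := by
  refine sectorCount_mixing_floor hμ hμ1 hu₀ hm hP (fun x => ?_) ht
  have h := drift_mixture hs0 hs1 (drift_exchange_sectorCount hQ hQA) (drift_prodKernel_sectorCount hM hw0 hw1 hfrozen) x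
  simp_rw [← hPdef] at h
  simpa using h

/-- **SWEEP-LIKE COMPOSED SCHEMES, REVERSIBLE OR NOT (`U` any update preserving the cold replicas' sector labels, then
ANY count-preserving exchange pass `Q`): `d(t) ≤ 1/4 ⇒ m̄ < 8·t`** — with `μ_k(A) ≥ a`, more than `(K+1)a/8` sweeps.
[ours] -/
theorem coldPreservingScheme_mixing_floor {U Q : Matrix (Fin (K + 1) → S) (Fin (K + 1) → S) ℝ}
    (hU : IsRowStochastic U) (hQ : IsRowStochastic Q)
    (hcold : ∀ x y, U x y ≠ 0 → ∀ k : Fin (K + 1), k ≠ 0 → (y k ∈ A ↔ x k ∈ A))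
    (hQA : ∀ x y, Q x y ≠ 0 → ∑ k, (if y k ∈ A then (1 : ℝ) else 0) = ∑ k, (if x k ∈ A then (1 : ℝ) else 0))
    {t : ℕ} (ht : worstTvDist (U * Q) (tensorFun μ) t ≤ 1 / 4) : ∑ k : Fin (K + 1), ∑ u ∈ A, μ k u < 8 * t := by
  have h := sectorCount_mixing_floor hμ hμ1 hu₀ hm (Decomposition.isRowStochastic_mul hU hQ)
    (fun x => by simpa using drift_comp hU (drift_coldPreserving_sectorCount hU hcold) (drift_exchange_sectorCount hQ hQA) x) ht
  linarith

end Floors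

end Summit.Ventures.LatticeQCDFlow.Scaling

end
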